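import Mathlib
import Summits.ValiantsHypothesis.ValiantsHypothesis.Theorems.MonotoneRestorationOrbitRestorationQPClusterMatching
import Summits.ValiantsHypothesis.ValiantsHypothesis.Theorems.MonotoneRestorationOrbitRestorationQPRankBoundBridge
import Summits.ValiantsHypothesis.ValiantsHypothesis.Theorems.MonotoneRestorationOrbitRestorationQPLevelRep
import HarnessLib

/-!
# The matching of cluster sums at a level (ORBIT currency)

Route MonotoneRestoration, crux `OrbitRestorationQP` (stmt-ValiantsHypothesis-18293), line `depth-three-rung`, registered stub
`stub_sigmaPiSigmaKValue` (A_k).  Namespace `Summit.ValiantsHypothesis.ValiantsHypothesis.Theorems.LevelRep`.  Route-independent.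

Layer L5 (a′) of the formalisation plan of `Cruxes/OrbitRestorationQP/Lines/depth-three-rung-stubA-bounded-fanin.md` (§2 (b)):
`match_of_fix` — **THE MATCHING LEMMA AT A LEVEL**: for a clean minimal representation `R` of `f` (`…LevelRep.lean`), an algebra
automorphism `φ` preserving total degrees with `φ f = f`, and a labelling `cl` of the terms that is GOOD for the rank distance
(diameter `Θ`, separation `> 2·Rb + Θ`, `Rb = 3(2m)²(⌊log₂ 2D⌋ + 1)`), `φ` permutes the cluster sums: every `φ (F_b)` is an `F_a`
and every `F_a` is a `φ (F_b)`.  The matching data of `…ClusterMatching.lean` are fed by the rank-bound bridge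
`…RankBoundBridge.lean` (minimal vanishing mixed families of `≥ 3` terms), by unique factorisation (`eq_of_add_eq_zero`, two
terms) and by minimality (mixedness).

Everything is proved modulo the named fact `depthThree_rankBound`, taken BY NAME as a hypothesis. [cite: KarninShpilka2009, §3;
SaxenaSeshadhri2013, Theorem 5]
-/

noncomputable section

open MvPolynomial Literature.Computability.AlgebraicComplexity

-- `Summit.ValiantsHypothesis.ValiantsHypothesis.…` is the tree's single-conjunct layout (Sub = Summit).
set_option linter.dupNamespace false

namespace Summit.ValiantsHypothesis.ValiantsHypothesis.Theorems

namespace LevelRep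

open RankDistance ClusterMatching RankBoundBridge LinNL

universe u

variable {K : Type} [Field K] {V : Type} [Fintype V] [DecidableEq V] [DecidableEq (MvPolynomial V K)]

/-! ### The matching lemma at a level -/

/-- The rank-bound constant of a clean representation with `m` terms: `3(2m)²(⌊log₂ 2D⌋ + 1)`. [cite: SaxenaSeshadhri2013, Theorem 5] -/
def Rb (m D : ℕ) : ℕ := 3 * (2 * m) ^ 2 * (Nat.log 2 (2 * D) + 1)

omit [Fintype V] [DecidableEq V] [DecidableEq (MvPolynomial V K)] in
/-- Two scaled products of normalised degree-`1` polynomials that sum to zero have the same factors. [folklore] -/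
theorem eq_of_add_eq_zero {a b : K} (ha : a ≠ 0) {L M : Multiset (MvPolynomial V K)}
    (hL : ∀ q ∈ L, q.totalDegree = 1) (hM : ∀ q ∈ M, q.totalDegree = 1) (hLn : IsNormalised L) (hMn : IsNormalised M)
    (h : C a * L.prod + C b * M.prod = 0) : L = M := by
  have hb : b ≠ 0 := by
    rintro rfl
    rw [C_0, zero_mul, add_zero, mul_eq_zero] at h
    rcases h with h | h
    · exact ha ((C_eq_zero).1 h)
    · rw [Multiset.prod_eq_zero_iff] at h
      have := hL 0 h; rw [totalDegree_zero] at this; exact zero_ne_one this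
  have hirrL : ∀ q ∈ L, Irreducible q := fun q hq => (prime_of_totalDegree_eq_one (hL q hq)).irreducible
  have hirrM : ∀ q ∈ M, Irreducible q := fun q hq => (prime_of_totalDegree_eq_one (hM q hq)).irreducible
  have hassoc : Associated L.prod M.prod := by
    have h1 : L.prod = C (-(b / a)) * M.prod := by
      have : C a * L.prod = -(C b * M.prod) := eq_neg_of_add_eq_zero_left h
      have ha' : (C a : MvPolynomial V K) ≠ 0 := (map_ne_zero_iff C (C_injective V K)).2 ha
      calc L.prod = C a⁻¹ * (C a * L.prod) := by rw [← mul_assoc, ← map_mul, inv_mul_cancel₀ ha, C_1, one_mul]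
        _ = C (-(b / a)) * M.prod := by rw [this, map_neg, div_eq_mul_inv, map_mul]; ring
    rw [h1]
    have hu : IsUnit (C (-(b / a)) : MvPolynomial V K) :=
      (isUnit_iff_ne_zero.2 (neg_ne_zero.2 (div_ne_zero hb ha))).map C
    obtain ⟨w, hw⟩ := hu
    exact ⟨w⁻¹, by rw [← hw]; rw [mul_comm (↑w : MvPolynomial V K), mul_assoc, Units.mul_inv, mul_one]⟩
  have hrel := UniqueFactorizationMonoid.factors_unique hirrL hirrM hassoc
  -- normalised and related ⇒ equal
  have key : L.map nrm = M.map nrm := by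
    rw [← Multiset.rel_eq, Multiset.rel_map]
    exact hrel.mono fun a _ b _ hab => nrm_eq_of_associated hab
  rw [Multiset.map_congr rfl (fun q hq => hLn q hq), Multiset.map_congr rfl (fun q hq => hMn q hq), Multiset.map_id',
    Multiset.map_id'] at key
  exact key

/-- **THE MATCHING LEMMA AT A LEVEL.**  Let `R` be a clean minimal representation of `f`, `cl` a labelling of its terms that is good for
the rank distance (diameter `≤ Θ`, separation `> 2·Rb + Θ`), and `φ` an algebra automorphism preserving total degrees with `φ f = f`.
Then `φ` permutes the cluster sums.  Granting the Saxena–Seshadhri rank bound. [cite: KarninShpilka2009, §3; SaxenaSeshadhri2013,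
Theorem 5] -/
theorem match_of_fix (hRB : depthThree_rankBound) {f : MvPolynomial V K} {D : ℕ} (R : CleanRep f D) {α : Type u}
    [DecidableEq α] (cl : Fin R.m → α) (Θ : ℕ) (hdiam : ∀ i j, cl i = cl j → rdist (R.L i) (R.L j) ≤ Θ)
    (hsep : ∀ i j, cl i ≠ cl j → 2 * Rb R.m D + Θ < rdist (R.L i) (R.L j))
    (φ : MvPolynomial V K ≃ₐ[K] MvPolynomial V K) (hφdeg : ∀ q, (φ q).totalDegree = q.totalDegree) (hφf : φ f = f) :
    (∀ a, ∃ b, φ (R.clusterSum cl b) = R.clusterSum cl a) ∧ (∀ b, ∃ a, φ (R.clusterSum cl b) = R.clusterSum cl a) := by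
  classical
  -- the images of the factor multisets and their scalars
  have hv : ∀ j, ∃ v : K, v ≠ 0 ∧ ((R.L j).map φ).prod = C v * (act φ (R.L j)).prod := by
    intro j
    have hrel : Multiset.Rel Associated (act φ (R.L j)) ((R.L j).map φ) := by
      rw [act, Multiset.rel_map]
      exact Multiset.rel_refl_of_refl_on fun q _ => nrm_associated (φ q)
    obtain ⟨w, hw⟩ := prod_associated_of_rel hrel
    obtain ⟨v, hv, hwv⟩ := MvPolynomial.isUnit_iff_eq_C_of_isReduced.1 w.isUnit
    exact ⟨v, hv.ne_zero, by rw [← hw, hwv, mul_comm]⟩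
  choose v hv0 hv using hv
  -- the matching data
  let Λt : Fin R.m ⊕ Fin R.m → Multiset (MvPolynomial V K) := Sum.elim R.L fun j => act φ (R.L j)
  let at' : Fin R.m ⊕ Fin R.m → K := Sum.elim R.a fun j => -(R.a j * v j)
  let val : Fin R.m ⊕ Fin R.m → MvPolynomial V K := fun x => C (at' x) * (Λt x).prod
  have hval_inl : ∀ i, val (Sum.inl i) = R.T i := fun i => rfl
  have hφC : ∀ c : K, φ (C c) = C c := fun c => by
    rw [← MvPolynomial.algebraMap_eq]; exact φ.commutes c
  have hval_inr : ∀ j, val (Sum.inr j) = -φ (R.T j) := fun j => by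
    show C (-(R.a j * v j)) * (act φ (R.L j)).prod = -φ (C (R.a j) * (R.L j).prod)
    rw [map_mul, hφC, map_multiset_prod, hv j, map_neg, map_mul]; ring
  have hΛdeg : ∀ x, ∀ q ∈ Λt x, q.totalDegree = 1 := by
    rintro (i | j) q hq
    · exact R.hdeg i q hq
    · obtain ⟨q', hq', rfl⟩ := Multiset.mem_map.1 hq
      rw [totalDegree_nrm, hφdeg]; exact R.hdeg j q' hq'
  have hΛnrm : ∀ x, IsNormalised (Λt x) := by
    rintro (i | j)
    · exact R.hnrm i
    · exact isNormalised_act φ (R.L j)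
  have hΛcard : ∀ x, Multiset.card (Λt x) ≤ D := by
    rintro (i | j)
    · exact R.hcard i
    · simp only [Λt, Sum.elim_inr, act, Multiset.card_map]; exact R.hcard j
  have hat0 : ∀ x, at' x ≠ 0 := by
    rintro (i | j)
    · exact R.ha i
    · exact neg_ne_zero.2 (mul_ne_zero (R.ha j) (hv0 j))
  have htotal : ∑ x, val x = 0 := by
    rw [Fintype.sum_sum_type]
    simp only [hval_inl, hval_inr, Finset.sum_neg_distrib, ← map_sum]
    have : ∑ i, R.T i = f := R.hsum
    rw [this, hφf, add_neg_cancel]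
  -- mixedness from minimality
  have hmixed : ∀ s : Finset (Fin R.m ⊕ Fin R.m), s.Nonempty → Vanishing val s →
      (∃ i, Sum.inl i ∈ s) ∧ ∃ j, Sum.inr j ∈ s := by
    intro s hs hvs
    have hsplit : ∑ x ∈ s, val x = ∑ i ∈ s.toLeft, R.T i - φ (∑ j ∈ s.toRight, R.T j) := by
      rw [← Finset.toLeft_disjSum_toRight (u := s), Finset.sum_disjSum, Finset.toLeft_disjSum_toRight]
      simp only [hval_inl, hval_inr, Finset.sum_neg_distrib, map_sum]
      ring
    unfold Vanishing at hvs
    rw [hsplit] at hvs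
    constructor
    · by_contra h
      have hl : s.toLeft = ∅ := Finset.eq_empty_of_forall_notMem fun i hi => h ⟨i, Finset.mem_toLeft.1 hi⟩
      rw [hl, Finset.sum_empty, zero_sub, neg_eq_zero, map_eq_zero_iff φ φ.injective] at hvs
      refine R.hmin s.toRight ?_ hvs
      obtain ⟨x, hx⟩ := hs
      rcases x with i | j
      · exact absurd ⟨i, hx⟩ h
      · exact ⟨j, Finset.mem_toRight.2 hx⟩
    · by_contra h
      have hr : s.toRight = ∅ := Finset.eq_empty_of_forall_notMem fun j hj => h ⟨j, Finset.mem_toRight.1 hj⟩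
      rw [hr, Finset.sum_empty, map_zero, sub_zero] at hvs
      refine R.hmin s.toLeft ?_ hvs
      obtain ⟨x, hx⟩ := hs
      rcases x with i | j
      · exact ⟨i, Finset.mem_toLeft.2 hx⟩
      · exact absurd ⟨j, hx⟩ h
  -- closeness from the rank bound
  have hclose : ∀ s : Finset (Fin R.m ⊕ Fin R.m), MinVanishing val s →
      ∀ x ∈ s, ∀ y ∈ s, rdist (Λt x) (Λt y) ≤ Rb R.m D := by
    intro s hs x hx y hy
    by_cases hxy : x = y
    · subst hxy; rw [rdist_self]; exact Nat.zero_le _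
    have h2 : 2 ≤ s.card := Finset.one_lt_card.2 ⟨x, hx, y, hy, hxy⟩
    rcases Nat.lt_or_ge s.card 3 with h3 | h3
    · -- two terms: equal factor multisets
      have hs2 : s = {x, y} := by
        refine (Finset.eq_of_subset_of_card_le (fun z hz => ?_) ?_).symm
        · simp only [Finset.mem_insert, Finset.mem_singleton] at hz
          rcases hz with rfl | rfl <;> assumption
        · rw [Finset.card_pair hxy]; omega
      have hsum2 : val x + val y = 0 := by
        have := hs.2.1
        unfold Vanishing at this
        rwa [hs2, Finset.sum_pair hxy] at this
      have := eq_of_add_eq_zero (hat0 x) (hΛdeg x) (hΛdeg y) (hΛnrm x) (hΛnrm y) hsum2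
      rw [this, rdist_self]; exact Nat.zero_le _
    · -- at least three terms: the rank bound
      let ι := ↥s
      have hcardι : Fintype.card ι = s.card := Fintype.card_coe s
      have hvan' : ∑ z : ι, C (at' z) * (Λt z).prod = 0 := by
        have := hs.2.1
        unfold Vanishing at this
        rw [← this, ← Finset.sum_coe_sort s]
      have hmin' : ∀ I : Finset ι, I.Nonempty → I ≠ Finset.univ → ∑ z ∈ I, C (at' z) * (Λt z).prod ≠ 0 := by
        intro I hI hIu h0
        set t : Finset (Fin R.m ⊕ Fin R.m) := I.map (Function.Embedding.subtype _) with ht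
        have hts : t ⊆ s := fun z hz => by
          obtain ⟨w, -, rfl⟩ := Finset.mem_map.1 hz
          exact w.2
        have htne : t ≠ s := by
          intro hts'
          apply hIu
          apply Finset.eq_univ_of_card
          rw [Fintype.card_coe, ← hts', ht, Finset.card_map]
        have htss : t ⊂ s := lt_of_le_of_ne hts htne
        refine hs.2.2 t htss (by simpa [ht] using hI) ?_
        unfold Vanishing
        rw [ht, Finset.sum_map]
        exact h0
      have hlt := rdist_lt_of_minVanishing hRB (fun z : ι => at' z) (fun z : ι => Λt z) D (fun z => hat0 z)
        (fun z => hΛdeg z) (fun z => hΛcard z)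
        (fun z w q hq q' hq' hqq' => by rw [← hΛnrm z q hq, ← hΛnrm w q' hq', nrm_eq_of_associated hqq'])
        hvan' hmin' (by rw [hcardι]; exact h3) ⟨x, hx⟩ ⟨y, hy⟩
      refine (Nat.le_of_lt_succ (Nat.lt_succ_of_lt hlt)).trans ?_
      unfold Rb
      rw [hcardι]
      have hsc : s.card ≤ 2 * R.m := by
        have := Finset.card_le_univ s
        rwa [Fintype.card_sum, Fintype.card_fin, ← two_mul] at this
      exact Nat.mul_le_mul_right _ (Nat.mul_le_mul_left _ (Nat.pow_le_pow_left hsc 2))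
  let Dm : MatchingData (Fin R.m) (MvPolynomial V K) :=
    { val := val
      Δ := fun x y => rdist (Λt x) (Λt y)
      δ := fun i j => rdist (R.L i) (R.L j)
      R := Rb R.m D
      total := htotal
      symm := fun x y => rdist_comm _ _
      triangle := fun x y z => rdist_triangle _ _ _
      inl_inl := fun i j => rfl
      inr_inr := fun i j => rdist_act φ (R.hnrm i) (R.hnrm j)
      close := hclose
      mixed := hmixed }
  have hgood : GoodLabelling Dm cl Θ := ⟨hdiam, hsep⟩
  have hfibre : ∀ a b : α, (∑ i ∈ Finset.univ.filter (fun i => cl i = a), Dm.val (Sum.inl i) +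
      ∑ j ∈ Finset.univ.filter (fun j => cl j = b), Dm.val (Sum.inr j) = 0) →
      φ (R.clusterSum cl b) = R.clusterSum cl a := by
    intro a b h
    have h' : R.clusterSum cl a - φ (R.clusterSum cl b) = 0 := by
      rw [CleanRep.clusterSum, CleanRep.clusterSum, map_sum, sub_eq_add_neg, ← Finset.sum_neg_distrib]
      simpa [Dm, hval_inl, hval_inr] using h
    exact (sub_eq_zero.1 h').symm
  refine ⟨fun a => ?_, fun b => ?_⟩
  · obtain ⟨b, hb⟩ := Dm.exists_match_left hgood a
    exact ⟨b, hfibre a b hb⟩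
  · obtain ⟨a, ha⟩ := Dm.exists_match_right hgood b
    exact ⟨a, hfibre a b ha⟩

end LevelRep

end Summit.ValiantsHypothesis.ValiantsHypothesis.Theorems

end
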